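import Summits.Ventures.HodgeRepro2.T5SU11KernelDifferenceTwoSidedGlobal

/-!
# The kernel's Neumann series beyond its first term converges uniformly on the WHOLE quadrant

Row 601 gave the uniform convergence of `K_λ = Σ_k (μ − μ₂)^k K_{λ₂}^{∘(k+1)}` on `{max(t, s) ≥ a}`. The first term `K_{λ₂}` is
singular at the corner, but the rest is not: with row 649's global domination `|K_{λ₂}^{∘(n+2)}(t, s)| ≤ C Ξ(t) Ξ(s)/(λ₂ − 1)^{2n}` and
`Ξ ≤ 1`, the Weierstrass `M`-test gives

* `tendstoUniformlyOn_kernel_sub_neumann` — **`Σ_{n<N} (μ − μ₂)^{n+1} K_{λ₂}^{∘(n+2)}(t, s) → K_λ(t, s) − K_{λ₂}(t, s)` uniformly on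
  `(0, ∞) × (0, ∞)`** for `|μ − μ₂| < (λ₂ − 1)²`;
* `abs_kernel_sub_partial_sum_le` — the explicit uniform remainder `C |μ − μ₂| ρ^N/(1 − ρ)`, `ρ = |μ − μ₂|/(λ₂ − 1)²`.

Nothing is claimed about (N).

Blind lane: Mathlib + the HodgeRepro2 prefix only; no sorry; axioms ⊆ {propext, Classical.choice,
Quot.sound}.
-/

namespace Summit.Ventures.HodgeRepro2.T5SU11KernelNeumannGlobal

open Filter Topology MeasureTheory
open Set (Ioi)
open T5SU11Cartan T5SU11SphericalFunction T5SU11SphericalBounds T5SU11SphericalDecay T5SU11RadialGreenKernel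
  T5SU11RadialGreenImproper T5SU11KernelCompositionTwoSidedGlobalAll T5SU11KernelDifferenceTwoSidedGlobal

section measure

variable [MeasurableSpace Circle] [BorelSpace Circle]

variable {lam lam₂ : ℝ} (hlam : 1 < lam) (hlam₂ : 1 < lam₂)

include hlam hlam₂ in
/-- **THE KERNEL'S NEUMANN SERIES BEYOND ITS FIRST TERM CONVERGES UNIFORMLY ON THE WHOLE QUADRANT**: for
`|μ − μ₂| < (λ₂ − 1)²`, `Σ_{n<N} (μ − μ₂)^{n+1} K_{λ₂}^{∘(n+2)}(t, s) → K_λ(t, s) − K_{λ₂}(t, s)` uniformly in `(t, s) ∈ (0, ∞)²`. -/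
theorem tendstoUniformlyOn_kernel_sub_neumann (hq : |lam * (lam - 2) - lam₂ * (lam₂ - 2)| < (lam₂ - 1) ^ 2) :
    TendstoUniformlyOn
      (fun N : ℕ => fun p : ℝ × ℝ => ∑ n ∈ Finset.range N, (lam * (lam - 2) - lam₂ * (lam₂ - 2)) ^ (n + 1)
        * ((greenSolI (fun t => sph lam₂ (hyp t)) (sphDecay lam₂))^[n + 1] (fun r => sphGreenKernel lam₂ r p.2)) p.1)
      (fun p : ℝ × ℝ => sphGreenKernel lam p.1 p.2 - sphGreenKernel lam₂ p.1 p.2) atTop (Ioi 0 ×ˢ Ioi 0) := by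
  obtain ⟨C, hC, hC'⟩ := exists_abs_kernel_comp_le_mul_sph_one_all hlam₂
  set q := lam * (lam - 2) - lam₂ * (lam₂ - 2) with hqdef
  set ρ := |q| / (lam₂ - 1) ^ 2 with hρ
  have hμ : 0 < (lam₂ - 1) ^ 2 := by positivity
  have hρ0 : 0 ≤ ρ := div_nonneg (abs_nonneg _) hμ.le
  have hρ1 : ρ < 1 := (div_lt_one hμ).mpr hq
  have hu : Summable (fun n : ℕ => C * |q| * ρ ^ n) := (summable_geometric_of_lt_one hρ0 hρ1).mul_left _
  have hbound : ∀ n : ℕ, ∀ p ∈ Ioi (0 : ℝ) ×ˢ Ioi (0 : ℝ),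
      ‖q ^ (n + 1) * ((greenSolI (fun t => sph lam₂ (hyp t)) (sphDecay lam₂))^[n + 1]
        (fun r => sphGreenKernel lam₂ r p.2)) p.1‖ ≤ C * |q| * ρ ^ n := by
    intro n p hp
    have ht : (0 : ℝ) < p.1 := hp.1
    have hs : (0 : ℝ) < p.2 := hp.2
    have h := hC' n p.1 p.2 ht hs
    have hΞt : sph 1 (hyp p.1) ≤ 1 := sph_hyp_le_one zero_le_one one_le_two p.1
    have hΞs : sph 1 (hyp p.2) ≤ 1 := sph_hyp_le_one zero_le_one one_le_two p.2
    have hΞt0 : 0 < sph 1 (hyp p.1) := sph_hyp_pos 1 p.1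
    have hΞs0 : 0 < sph 1 (hyp p.2) := sph_hyp_pos 1 p.2
    have hqn : 0 ≤ |q| ^ n := pow_nonneg (abs_nonneg _) n
    have hCn : 0 ≤ C / ((lam₂ - 1) ^ 2) ^ n := by positivity
    rw [Real.norm_eq_abs, abs_mul, abs_pow, pow_succ]
    calc |q| ^ n * |q| * |((greenSolI (fun t => sph lam₂ (hyp t)) (sphDecay lam₂))^[n + 1]
          (fun r => sphGreenKernel lam₂ r p.2)) p.1|
        ≤ |q| ^ n * |q| * (C / ((lam₂ - 1) ^ 2) ^ n * sph 1 (hyp p.1) * sph 1 (hyp p.2)) :=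
          mul_le_mul_of_nonneg_left h (mul_nonneg hqn (abs_nonneg _))
      _ ≤ |q| ^ n * |q| * (C / ((lam₂ - 1) ^ 2) ^ n * 1 * 1) := by
          refine mul_le_mul_of_nonneg_left ?_ (mul_nonneg hqn (abs_nonneg _))
          exact mul_le_mul (mul_le_mul_of_nonneg_left hΞt hCn) hΞs hΞs0.le (by positivity)
      _ = C * |q| * ρ ^ n := by
          rw [hρ, div_pow]
          field_simp
  have h := tendstoUniformlyOn_tsum_nat hu hbound
  refine h.congr_right fun p hp => ?_
  have ht : (0 : ℝ) < p.1 := hp.1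
  have hs : (0 : ℝ) < p.2 := hp.2
  exact (hasSum_kernel_sub_neumann hlam hlam₂ hq ht hs).tsum_eq

include hlam hlam₂ in
/-- **The explicit uniform remainder**: `|K_λ(t, s) − K_{λ₂}(t, s) − Σ_{n<N} (μ − μ₂)^{n+1} K_{λ₂}^{∘(n+2)}(t, s)| ≤ C |μ − μ₂| ρ^N/(1 − ρ)`
for all `t, s > 0`, `ρ = |μ − μ₂|/(λ₂ − 1)²`. -/
theorem abs_kernel_sub_partial_sum_le (hq : |lam * (lam - 2) - lam₂ * (lam₂ - 2)| < (lam₂ - 1) ^ 2) :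
    ∃ C : ℝ, 0 < C ∧ ∀ N : ℕ, ∀ t s, 0 < t → 0 < s →
      |sphGreenKernel lam t s - sphGreenKernel lam₂ t s
        - ∑ n ∈ Finset.range N, (lam * (lam - 2) - lam₂ * (lam₂ - 2)) ^ (n + 1)
          * ((greenSolI (fun t => sph lam₂ (hyp t)) (sphDecay lam₂))^[n + 1] (fun r => sphGreenKernel lam₂ r s)) t|
        ≤ C * |lam * (lam - 2) - lam₂ * (lam₂ - 2)|
          * (|lam * (lam - 2) - lam₂ * (lam₂ - 2)| / (lam₂ - 1) ^ 2) ^ N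
          / (1 - |lam * (lam - 2) - lam₂ * (lam₂ - 2)| / (lam₂ - 1) ^ 2) := by
  obtain ⟨C, hC, hC'⟩ := exists_abs_kernel_comp_le_mul_sph_one_all hlam₂
  set q := lam * (lam - 2) - lam₂ * (lam₂ - 2) with hqdef
  set ρ := |q| / (lam₂ - 1) ^ 2 with hρ
  have hμ : 0 < (lam₂ - 1) ^ 2 := by positivity
  have hρ0 : 0 ≤ ρ := div_nonneg (abs_nonneg _) hμ.le
  have hρ1 : ρ < 1 := (div_lt_one hμ).mpr hq
  refine ⟨C, hC, fun N t s ht hs => ?_⟩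
  have hsum := hasSum_kernel_sub_neumann hlam hlam₂ hq ht hs
  -- the tail `Σ_{n ≥ N}` as a sum over `n + N`
  have htail := (hasSum_nat_add_iff' N).mpr hsum
  have hterm : ∀ n : ℕ, |q ^ (n + N + 1)
      * ((greenSolI (fun t => sph lam₂ (hyp t)) (sphDecay lam₂))^[n + N + 1] (fun r => sphGreenKernel lam₂ r s)) t|
      ≤ C * |q| * ρ ^ N * ρ ^ n := by
    intro n
    have h := hC' (n + N) t s ht hs
    have hΞt : sph 1 (hyp t) ≤ 1 := sph_hyp_le_one zero_le_one one_le_two t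
    have hΞs : sph 1 (hyp s) ≤ 1 := sph_hyp_le_one zero_le_one one_le_two s
    have hΞt0 : 0 < sph 1 (hyp t) := sph_hyp_pos 1 t
    have hΞs0 : 0 < sph 1 (hyp s) := sph_hyp_pos 1 s
    have hqn : 0 ≤ |q| ^ (n + N) := pow_nonneg (abs_nonneg _) _
    have hCn : 0 ≤ C / ((lam₂ - 1) ^ 2) ^ (n + N) := by positivity
    rw [abs_mul, abs_pow, pow_succ]
    calc |q| ^ (n + N) * |q| * |((greenSolI (fun t => sph lam₂ (hyp t)) (sphDecay lam₂))^[n + N + 1]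
          (fun r => sphGreenKernel lam₂ r s)) t|
        ≤ |q| ^ (n + N) * |q| * (C / ((lam₂ - 1) ^ 2) ^ (n + N) * sph 1 (hyp t) * sph 1 (hyp s)) :=
          mul_le_mul_of_nonneg_left h (mul_nonneg hqn (abs_nonneg _))
      _ ≤ |q| ^ (n + N) * |q| * (C / ((lam₂ - 1) ^ 2) ^ (n + N) * 1 * 1) := by
          refine mul_le_mul_of_nonneg_left ?_ (mul_nonneg hqn (abs_nonneg _))
          exact mul_le_mul (mul_le_mul_of_nonneg_left hΞt hCn) hΞs hΞs0.le (by positivity)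
      _ = C * |q| * ρ ^ N * ρ ^ n := by
          have e : ρ ^ N * ρ ^ n = |q| ^ (n + N) / ((lam₂ - 1) ^ 2) ^ (n + N) := by
            rw [hρ, ← pow_add, div_pow, add_comm N n]
          rw [mul_assoc (C * |q|), e]
          field_simp
  have hgeom : Summable (fun n : ℕ => C * |q| * ρ ^ N * ρ ^ n) :=
    (summable_geometric_of_lt_one hρ0 hρ1).mul_left _
  have habs : Summable (fun n : ℕ => |q ^ (n + N + 1)
      * ((greenSolI (fun t => sph lam₂ (hyp t)) (sphDecay lam₂))^[n + N + 1] (fun r => sphGreenKernel lam₂ r s)) t|) :=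
    Summable.of_nonneg_of_le (fun n => abs_nonneg _) hterm hgeom
  rw [← htail.tsum_eq]
  calc |∑' n : ℕ, q ^ (n + N + 1)
        * ((greenSolI (fun t => sph lam₂ (hyp t)) (sphDecay lam₂))^[n + N + 1] (fun r => sphGreenKernel lam₂ r s)) t|
      ≤ ∑' n : ℕ, |q ^ (n + N + 1)
        * ((greenSolI (fun t => sph lam₂ (hyp t)) (sphDecay lam₂))^[n + N + 1] (fun r => sphGreenKernel lam₂ r s)) t| := by
        have := norm_tsum_le_tsum_norm (f := fun n : ℕ => q ^ (n + N + 1)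
          * ((greenSolI (fun t => sph lam₂ (hyp t)) (sphDecay lam₂))^[n + N + 1] (fun r => sphGreenKernel lam₂ r s)) t)
          (by simpa only [Real.norm_eq_abs] using habs)
        simpa only [Real.norm_eq_abs] using this
    _ ≤ ∑' n : ℕ, C * |q| * ρ ^ N * ρ ^ n := Summable.tsum_le_tsum hterm habs hgeom
    _ = C * |q| * ρ ^ N * (1 - ρ)⁻¹ := by rw [tsum_mul_left, tsum_geometric_of_lt_one hρ0 hρ1]
    _ = C * |q| * ρ ^ N / (1 - ρ) := by rw [div_eq_mul_inv]

end measure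

end Summit.Ventures.HodgeRepro2.T5SU11KernelNeumannGlobal
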